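import Summits.AtomisticToContinuum.HydrodynamicLimit.Theorems.KineticFluxLdDecay.Negative.GibbsTilts

/-!
# Gibbs tilts for `KineticFluxLdDecay` (5/5): the normalisation `|φ| ≤ 1` carries the amplitude

`KineticFluxLdDecayWithoutPhiBound` — the crux VERBATIM with the normalisation `(∀ x, |φ x| ≤ 1)` of the spatial
test function deleted — is FALSE: `φ ≡ 16/κ'` moves the amplitude into `φ ⊗ g`, and with the admissible
`g = (κ'/2)(cos v₁ − cos v₀)` (`|g| ≤ κ' = min κ 1`, `⊥ span{1, v, |v|²}` by swap symmetry and parity) the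
functional is that of `8 (cos v₁ − cos v₀)`, killed by the drift tilt of `kineticFluxLdDecay_false_allAmplitudes`
(gain `8 e^{-1/2}(1 − cos 1) ≥ 43/24` against cost `1/2`, at every window, uniformly in `N`).
refuter-cdisprove-stmt-AtomisticToContinuum-10967-0.
-/

noncomputable section

open MeasureTheory ProbabilityTheory Real
open scoped ENNReal InnerProductSpace

namespace Summit.AtomisticToContinuum.HydrodynamicLimit.Theorems

open Literature.MathematicalPhysics.KineticTheory Literature.Analysis.FluidPDE
open Summit.AtomisticToContinuum.HydrodynamicLimit.Theses.AntiMazurCoboundaries (KineticFluxLdDecay)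
open KineticFluxLdDecayTilt

/-! ### (N6) The normalisation `|φ| ≤ 1` carries the amplitude -/

/-- The crux with the normalisation `(∀ x, |φ x| ≤ 1)` of the spatial test function DROPPED (all else
verbatim: `φ` is any continuous function on `𝕋³`, the amplitude clause `|g| ≤ κ` is kept). -/
def KineticFluxLdDecayWithoutPhiBound : Prop :=
  ∀ (a θ : ℝ) (u₀ : V3), 0 < a → 0 < θ → ∃ σ₀ : ℝ, 0 < σ₀ ∧ ∀ σ : ℝ, 0 < σ → σ < σ₀ →
    (∀ (N : ℕ) (Φ : HardSphereFlow (Torus.geometry (Fin 3)) (hsDiameter σ N) (N + 1)),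
      IsProbabilityMeasure (localGibbsLaw σ (fun _ => a) (fun _ => u₀) (fun _ => θ) N Φ)) ∧
    ∃ κ : ℝ, 0 < κ ∧ ∀ (φ : T3 → ℝ) (g : V3 → ℝ), Continuous φ → Continuous g →
      (∀ v, |g v| ≤ κ) → (∀ (c₀ c₂ : ℝ) (b : V3),
        ∫ v, g v * (c₀ + inner ℝ b v + c₂ * ‖v‖ ^ 2) ∂(stdGaussian V3) = 0) →
      ∀ δ : ℝ, 0 < δ → ∃ τ : ℝ, 0 < τ ∧ ∃ N₀ : ℕ, ∀ N : ℕ, N₀ ≤ N →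
        ∀ Φ : HardSphereFlow (Torus.geometry (Fin 3)) (hsDiameter σ N) (N + 1),
          ∫⁻ z, ENNReal.ofReal (Real.exp ((τ * ((N + 1 : ℕ) : ℝ) ^ (-(1 / 3 : ℝ)))⁻¹ *
            ∫ s in (0 : ℝ)..(τ * ((N + 1 : ℕ) : ℝ) ^ (-(1 / 3 : ℝ))),
              ∑ i, φ (Φ.flow s z i).1 * g ((Real.sqrt θ)⁻¹ • ((Φ.flow s z i).2 - u₀))))
            ∂(localGibbsLaw σ (fun _ => a) (fun _ => u₀) (fun _ => θ) N Φ) ≤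
          ENNReal.ofReal (Real.exp (δ * (N + 1)))

/-- Sanity (contrapositive form): a refutation of the crux would refute the variant. [folklore] -/
theorem not_withoutPhiBound_of_not_crux (hn : ¬ KineticFluxLdDecay) : ¬ KineticFluxLdDecayWithoutPhiBound :=
  fun h => hn <| by
    intro a θ u₀ ha hθ
    obtain ⟨σ₀, hσ₀, H⟩ := h a θ u₀ ha hθ
    refine ⟨σ₀, hσ₀, fun σ hσ hσ' => ?_⟩
    obtain ⟨hA, κ, hκ, hB⟩ := H σ hσ hσ'
    exact ⟨hA, κ, hκ, fun φ g hφ hg _ hgκ horth => hB φ g hφ hg hgκ horth⟩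

/-- Unpacking the `φ`-unbounded variant at the reference point with a CONSTANT test function `φ ≡ C`:
the bound becomes the tilt-shaped bound for the observable `C · g`. [folklore] -/
theorem KineticFluxLdDecayWithoutPhiBound.unpack (h : KineticFluxLdDecayWithoutPhiBound) :
    ∃ σ : ℝ, ∃ hσ : 0 < σ, ∃ hσ' : σ < 2⁻¹, ∃ κ : ℝ, 0 < κ ∧ ∀ (C : ℝ) (g : V3 → ℝ), Continuous g →
      (∀ v, |g v| ≤ κ) → (∀ (c₀ c₂ : ℝ) (b : V3),
        ∫ v, g v * (c₀ + inner ℝ b v + c₂ * ‖v‖ ^ 2) ∂(stdGaussian V3) = 0) →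
      ∀ δ : ℝ, 0 < δ → ∃ h : ℝ, 0 < h ∧ ∃ N : ℕ,
        ∫⁻ z, ENNReal.ofReal (Real.exp (h⁻¹ * ∫ s in (0 : ℝ)..h,
            ∑ i, (fun v => C * g v) (((regFlowCrux hσ hσ' N).flow s z i).2)))
          ∂(localGibbsLaw σ (fun _ => 1) (fun _ => 0) (fun _ => 1) N (regFlowCrux hσ hσ' N)) ≤
        ENNReal.ofReal (Real.exp (δ * (N + 1))) := by
  obtain ⟨σ₀, hσ₀, H⟩ := h 1 1 0 one_pos one_pos
  have hσpos : 0 < min (σ₀ / 2) 4⁻¹ := lt_min (by positivity) (by norm_num)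
  have hσlt : min (σ₀ / 2) 4⁻¹ < σ₀ := (min_le_left _ _).trans_lt (by linarith)
  have hσhalf : min (σ₀ / 2) 4⁻¹ < 2⁻¹ := (min_le_right _ _).trans_lt (by norm_num)
  refine ⟨min (σ₀ / 2) 4⁻¹, hσpos, hσhalf, ?_⟩
  obtain ⟨-, κ, hκ, hB⟩ := H _ hσpos hσlt
  refine ⟨κ, hκ, fun C g hg hgκ horth δ hδ => ?_⟩
  obtain ⟨τ, hτ, N₀, hN⟩ := hB (fun _ => C) g continuous_const hg hgκ horth δ hδ
  refine ⟨τ * ((N₀ + 1 : ℕ) : ℝ) ^ (-(1 / 3 : ℝ)), mul_pos hτ (Real.rpow_pos_of_pos (by positivity) _),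
    N₀, ?_⟩
  have key := hN N₀ le_rfl (regFlowCrux hσpos hσhalf N₀)
  simpa only [Real.sqrt_one, inv_one, one_smul, sub_zero] using key

/-- **`|φ| ≤ 1` is load-bearing (it carries the amplitude of `φ ⊗ g`)**: with `φ ≡ 16/κ'` and the
admissible `g = (κ'/2)(cos v₁ − cos v₀)` (`|g| ≤ κ' = min κ 1`, `⊥ span{1, v, |v|²}`) the functional is that
of `8 (cos v₁ − cos v₀)`, refuted by the drift tilt of `kineticFluxLdDecay_false_allAmplitudes`. [folklore] -/
theorem kineticFluxLdDecay_false_without_phiBound : ¬ KineticFluxLdDecayWithoutPhiBound := by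
  intro h
  obtain ⟨σ, hσ, hσ', κ, hκ, H⟩ := h.unpack
  obtain ⟨hc_lo, hc_hi⟩ := exp_neg_half_bounds
  set c : ℝ := Real.exp (-1 / 2) with hc
  set κ' : ℝ := min κ 1 with hκ'
  have hκ'pos : 0 < κ' := lt_min hκ one_pos
  have hκ'le : κ' ≤ κ := min_le_left _ _
  set g : V3 → ℝ := fun v => κ' / 2 * (Real.cos (v 1) - Real.cos (v 0)) with hg
  have hgc : Continuous g := continuous_const.mul
    ((Real.continuous_cos.comp (continuous_coord 1)).sub (Real.continuous_cos.comp (continuous_coord 0)))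
  have hcos2 : ∀ v : V3, |Real.cos (v 1) - Real.cos (v 0)| ≤ 2 := fun v => by
    have h1 := Real.abs_cos_le_one (v 0)
    have h2 := Real.abs_cos_le_one (v 1)
    calc _ ≤ |Real.cos (v 1)| + |Real.cos (v 0)| := abs_sub _ _
      _ ≤ 2 := by linarith
  have hgK : ∀ v, |g v| ≤ κ' := fun v => by
    rw [hg]; dsimp only; rw [abs_mul, abs_of_pos (by positivity : 0 < κ' / 2)]
    nlinarith [hcos2 v]
  have horth : ∀ (c₀ c₂ : ℝ) (b : V3),
      ∫ v, g v * (c₀ + inner ℝ b v + c₂ * ‖v‖ ^ 2) ∂stdGaussian V3 = 0 := by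
    intro c₀ c₂ b
    have hsplit : ∀ v : V3, g v * (c₀ + inner ℝ b v + c₂ * ‖v‖ ^ 2) =
        g v * (c₀ + c₂ * ‖v‖ ^ 2) + g v * ⟪b, v⟫_ℝ := fun v => by ring
    simp_rw [hsplit]
    have hi1 : Integrable (fun v : V3 => g v * (c₀ + c₂ * ‖v‖ ^ 2)) (stdGaussian V3) :=
      ((integrable_const c₀).add (integrable_norm_sq_stdGaussian.const_mul c₂)).bdd_mul
        hgc.aestronglyMeasurable (ae_of_all _ fun v => by rw [Real.norm_eq_abs]; exact hgK v)
    have hi2 : Integrable (fun v => g v * ⟪b, v⟫_ℝ) (stdGaussian V3) :=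
      (integrable_inner_stdGaussian b).bdd_mul hgc.aestronglyMeasurable
        (ae_of_all _ fun v => by rw [Real.norm_eq_abs]; exact hgK v)
    rw [integral_add hi1 hi2,
      integral_eq_zero_of_odd_stdGaussian (f := fun v : V3 => g v * ⟪b, v⟫_ℝ) fun v => by
        simp only [hg, PiLp.neg_apply, Real.cos_neg, inner_neg_right]; ring]
    have hanti : ∀ v : V3, g (swap01 v) * (c₀ + c₂ * ‖swap01 v‖ ^ 2) =
        -(g v * (c₀ + c₂ * ‖v‖ ^ 2)) := fun v => by
      rw [LinearIsometryEquiv.norm_map, hg]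
      dsimp only
      rw [swap01_apply_zero, swap01_apply_one]
      ring
    have hinv := integral_comp_linearIsometryEquiv_stdGaussian swap01
      (fun v : V3 => g v * (c₀ + c₂ * ‖v‖ ^ 2))
    simp only [hanti, integral_neg] at hinv
    linarith
  obtain ⟨hh, hhpos, N, hN⟩ := H (16 / κ') g hgc (fun v => (hgK v).trans hκ'le) horth (1 / 2) (by norm_num)
  -- the effective observable `C · g = 8 (cos v₁ − cos v₀)`
  have hgc' : Continuous fun v : V3 => 16 / κ' * g v := continuous_const.mul hgc
  have hgK' : ∀ v : V3, |16 / κ' * g v| ≤ 16 := fun v => by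
    rw [abs_mul, abs_of_pos (by positivity : 0 < 16 / κ')]
    have := hgK v
    calc 16 / κ' * |g v| ≤ 16 / κ' * κ' := mul_le_mul_of_nonneg_left this (by positivity)
      _ = 16 := by field_simp
  have hΓ := KineticFluxLdDecayWith.gamma_le one_pos (EuclideanSpace.single (0 : Fin 3) (1 : ℝ))
    hgc' hgK' hhpos hN
  have hshift : ∀ w : V3, 16 / κ' * g (EuclideanSpace.single (0 : Fin 3) (1 : ℝ) + Real.sqrt 1 • w) =
      8 * (Real.cos (0 + 1 * w 1) - Real.cos (1 + 1 * w 0)) := fun w => by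
    simp only [hg]
    have : (16 : ℝ) / κ' * (κ' / 2) = 8 := by field_simp; norm_num
    simp [← mul_assoc, this]
  rw [integral_add (integrable_comp_shift_of_abs_le hgc' hgK' _ _) (integrable_llr1_comp_shift one_pos _),
    integral_llr1_drift] at hΓ
  simp_rw [hshift] at hΓ
  have hci1 : Integrable (fun w : V3 => Real.cos (0 + 1 * w 1)) (stdGaussian V3) :=
    integrable_of_abs_le_stdGaussian (f := fun w : V3 => Real.cos (0 + 1 * w 1))
      (Real.continuous_cos.comp (continuous_const.add (continuous_const.mul (continuous_coord 1))))
      fun v => Real.abs_cos_le_one _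
  have hci0 : Integrable (fun w : V3 => Real.cos (1 + 1 * w 0)) (stdGaussian V3) :=
    integrable_of_abs_le_stdGaussian (f := fun w : V3 => Real.cos (1 + 1 * w 0))
      (Real.continuous_cos.comp (continuous_const.add (continuous_const.mul (continuous_coord 0))))
      fun v => Real.abs_cos_le_one _
  rw [integral_const_mul, integral_sub hci1 hci0, integral_cos_coord, integral_cos_coord, PiLp.norm_single,
    Real.cos_zero] at hΓ
  simp only [Real.norm_eq_abs, abs_one, one_pow, mul_one] at hΓ
  norm_num at hΓ
  rw [show Real.exp (-(1 / 2) : ℝ) = c by rw [hc]; norm_num] at hΓ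
  have hcos := KineticFluxLdDecayTilt.one_sub_cos_one_ge
  nlinarith [mul_le_mul_of_nonneg_left hcos (by linarith : (0:ℝ) ≤ c)]

end Summit.AtomisticToContinuum.HydrodynamicLimit.Theorems
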